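import Summits.BirchSwinnertonDyer.BirchSwinnertonDyer.Theorems.RamifiedHeegnerPairLeafPartnerTwist
import Literature.NumberTheory.DiophantineGeometry.TateAlgorithmTameTypesOddProofs
import Literature.NumberTheory.EllipticCurves.ManinConstantQuadraticTwistAtTwoProofs
import Literature.NumberTheory.EllipticCurves.EichlerShimuraConstructionProofs
import Literature.NumberTheory.EllipticCurves.Pal2012.QuadraticTwistPeriodProofs
import Literature.NumberTheory.EllipticCurves.NeronLocalHeightCompletion
import Literature.NumberTheory.GaloisRepresentations.HeckeCharacterProofs
import Mathlib.NumberTheory.Padics.HeightOneSpectrum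
import HarnessLib

/-!
# Route `RamifiedHeegnerPair`, cruxes U₁ `LeafRankOneUpperAtThree` (stmt-BirchSwinnertonDyer-26022) ∕ U₀ (26024), line `partnerdescent` —
# the `3`-ADIC PERIOD LEDGER of the (DISPLAY-L) stub: `covol(Λ_V) = 3 · covol(Λ_W)` for the `3`-good twist partner (partner kernel part 8)

HONEST FRAMING. Theorems only; helper file (`--supports stmt-BirchSwinnertonDyer-26022 --as helper`); no definition, no named fact, no
`sorry`; nothing is booked, no item closes; BSD is proved for no curve. Lead prover bsd-line-rhp-p2 g56, 2026-08-30.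

WHY. The line's print-composite stub (DISPLAY-L) `stub_partnerGenusDisplayLabelledAtThree` displays `L′(W/K,1)` through the REAL constant
`2covol(Λ_W)·deg(D₀)/(c(D₀)²(w_K/2)²√|d_K|)` read for the LEAF curve `W`, while Cai–Shu–Tian's explicit Gross–Zagier formula for the
partner `(V, χ₋₃∘Nm)` (`V` = a global minimal model of `W ⊗ χ₋₃`, conductor `c = 3` of the genus character) carries
`8π²(φ_V,φ_V)/(u²√|d_K c²|)` and Zagier's `8π²(φ_V,φ_V) = 2covol(Λ_{V₀})deg(D₀)/c(D₀)²`. The stub's docstring claims that the `3 = √(c²)` in the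
denominator CANCELS against `covol(Λ_V) = 3·covol(Λ_W)` (twist by the `3`-uniformiser `−3` of a Kodaira `I₀*` fibre). A stray power of `3` here
would MISSTATE the stub (only `3`-adic units are absorbed by rescaling `(degS, P)`); the line's g55 lead flagged exactly this as the thing a
disprover should check. THIS FILE proves the ledger entry: for a leaf curve `W` (`Addv W 3`, `SubGss W 3`, globally minimal) and ANY globally
minimal `V = C_V • W^{(−3)}`, and any Néron-type period pairs `L` of `W` and `L_V` of `V`: `covol(Λ_V) = 3 · covol(Λ_W)`.
Proof: `Λ(W^{(−3)}) = s⁻¹Λ(W)` with `s² = −3` (Pal Lemma 3.1, tree `isNeronLatticeOf_quadraticTwist_of_sq_eq`), `Λ(C_V • T) = u Λ(T)`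
(`IsNeronLatticeOf.lattice_eq_mulLeft_of_smul`), so `covol(Λ_V) = |u|² covol(Λ_W)/3`; and `|u| = 3`: `u` is a unit at every place `v ≠ 3`
(Pal Prop. 2.5: `v ∤ 2d` and `d = −3 ≡ 1 (mod 4)` at `v = 2`), while at `3` the discriminants give `12·ord₃ u = 6 + ord₃ Δ_W = 12`
(`Δ_V = u⁻¹² (−3)⁶ Δ_W`, `ord₃ Δ_V = 0` since `V` is good at `3`, `ord₃ Δ_W = 6` on the Kodaira `I₀*` leaf), so `u/3` is a unit everywhere,
i.e. `u = ±3`.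
* §1 `padicValRat_three_u_eq_one` — `ord₃ u(C_V) = 1`.
* §2 `u_eq_three_or_eq_neg_three` — `u(C_V) = ±3`.
* §3 `covolume_partner_eq_three_mul` — **`covol(Λ_V) = 3 · covol(Λ_W)`**.
References (locators only): [cite: Pal2012, Prop. 2.5, Lemma 3.1 and Remark 2.3] [cite: SilvermanAEC2009, VII.1 Prop. 1.3(b), III.1 Table 3.1]
[cite: SilvermanATAEC1994, IV Table 4.1 (I₀*: ord Δ = 6), IV.11.1 table p. 368] [cite: CaiShuTian2014, Thm. 1.1 (u²√|Dc²|)] [cite: ZagierCMB1985, §1].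
presearch: «period lattice of a quadratic twist / covolume under twist by −3» → Pal 2012 Lemma 3.1 + Prop. 2.5 (tree theorems, reused, not
restated). Axioms: `propext`, `Classical.choice`, `Quot.sound`.
-/

set_option autoImplicit false
set_option linter.dupNamespace false

noncomputable section

open scoped Classical NumberField

namespace Summit.BirchSwinnertonDyer.BirchSwinnertonDyer.Theorems.LeafPartnerCovolume

open WeierstrassCurve NumberField IsDedekindDomain Literature Literature.NumberTheory.EllipticCurves
  Rat.HeightOneSpectrum
  Literature.NumberTheory.EllipticCurves.ModularForms
  Literature.NumberTheory.EllipticCurves.Rank1Residual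
  Summit.BirchSwinnertonDyer.Rank1Residual
  Summit.BirchSwinnertonDyer.Rank1Residual.Additive
  Summit.BirchSwinnertonDyer.BirchSwinnertonDyer.Theorems

/-! ## §0 The bridge `|·|_v = exp(−ord_p ·)` at the places of `𝓞 ℚ` -/

/-- **The `v`-adic valuation of `ℚ` is the `p`-adic one**, `p = natGenerator v`, for the places of `𝓞 ℚ` (Mathlib: the two valuations are
equivalent, `valuation_equiv_padicValuation`; both send `p` to `exp(−1)`).
-- adapted from Literature/NumberTheory/EllipticCurves/Curve6137MuDescentSelmer.lean (private `valuation_eq_exp_neg_padicValRat'`)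
[folklore] -/
theorem valuation_eq_exp_neg_padicValRat_ringOfIntegers (v : HeightOneSpectrum (𝓞 ℚ)) {x : ℚ} (hx : x ≠ 0) :
    v.valuation ℚ x = WithZero.exp (-padicValRat (natGenerator v) x) := by
  haveI hp : Fact (natGenerator v).Prime := ⟨prime_natGenerator v⟩
  haveI hp' : Fact (Nat.Prime ((primesEquiv v : Nat.Primes) : ℕ)) := ⟨(primesEquiv v).2⟩
  have hequiv := valuation_equiv_padicValuation v
  set n : ℤ := padicValRat (natGenerator v) x with hn
  have h2x : Rat.padicValuation (primesEquiv v) x = WithZero.exp (-n) := by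
    change Rat.padicValuation (natGenerator v) x = _
    simp [Rat.padicValuation, hx, hn]
  have h2p : Rat.padicValuation (primesEquiv v) ((natGenerator v : ℚ) ^ n) = WithZero.exp (-n) := by
    change Rat.padicValuation (natGenerator v) _ = _
    rw [map_zpow₀, Rat.padicValuation_self, ← WithZero.exp_zsmul]
    simp
  have h1p : v.valuation ℚ ((natGenerator v : ℚ) ^ n) = WithZero.exp (-n) := by
    rw [map_zpow₀, Literature.NumberTheory.GaloisRepresentations.Rat.valuation_natGenerator, ← WithZero.exp_zsmul]
    simp
  rw [← h1p]
  exact (hequiv.eq_iff).mpr (h2x.trans h2p.symm)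

/-! ## §1 `ord₃ u = 1` -/

/-- **`ord₃ u(C_V) = 1`** for a globally minimal model `V = C_V • W^{(−3)}` of the `3`-good twist partner of a leaf curve `W`:
`Δ(V) = u⁻¹² · (−3)⁶ · Δ(W)` (Mathlib `variableChange_Δ`, tree `quadraticTwist_Δ`), `ord₃ Δ(V) = 0` (`V` good at `3`,
`hasGoodReductionAtPrime_three_of_smul_eq_quadraticTwist_negThree`, minimal discriminant prime to `3`), `ord₃ Δ(W) = 6` (Kodaira `I₀*` at `3`
on the leaf, `padicValRat_Δ_of_kodairaSymbolAt_Istar`). [cite: SilvermanATAEC1994, IV Table 4.1] [cite: Pal2012, Remark 2.3] -/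
theorem padicValRat_three_u_eq_one
    (W : WeierstrassCurve ℚ) [W.IsElliptic] [W.IsGloballyMinimal] (hadd : Addv W 3) (hsub : SubGss W 3)
    {V : WeierstrassCurve ℚ} [V.IsElliptic] [V.IsGloballyMinimal]
    (CV : VariableChange ℚ) (hV : CV • W.quadraticTwist (-3) = V) :
    padicValRat 3 (CV.u : ℚ) = 1 := by
  haveI h3F : Fact (Nat.Prime 3) := ⟨Nat.prime_three⟩
  -- `ord₃ Δ(W) = 6` (Kodaira `I₀*`)
  have hK : W.kodairaSymbolAt (Additive.placeOf 3) = .Istar 0 :=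
    RamifiedPairUpperBound.kodairaSymbolAt_three_eq_Istar_zero_of_subGss W hadd hsub
  have hΔW : padicValRat 3 W.Δ = 6 := by
    -- Ogg/Tate Table 4.1 on the globally minimal `W`: `ord₃ Δ = m + 1 = 5 + 1` for `I₀*`
    -- adapted from Summits/BirchSwinnertonDyer/Rank1Residual/O5/TrivialKummerImagePotTwistThreeProofs.lean (`padicValRat_Δ_of_kodairaSymbolAt_Istar`)
    haveI : PerfectField (IsLocalRing.ResidueField ((Additive.placeOf 3).adicCompletionIntegers ℚ)) :=
      PerfectField.ofFinite
    have h2 : ringChar (ℤ ⧸ (Additive.placeOf 3).asIdeal) ≠ 2 := by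
      rw [Additive.ringChar_int_quot_placeOf 3]; decide
    have hord := W.ordMinimalDiscriminant_eq_numComponentsAt_add_one_of_kodairaSymbolAt (Additive.placeOf 3) h2
      (Or.inr (Or.inr ⟨0, hK⟩))
    rw [Additive.ordMinimalDiscriminant_placeOf_eq W 3] at hord
    unfold WeierstrassCurve.numComponentsAt at hord
    rw [hK, Literature.NumberTheory.DiophantineGeometry.KodairaSymbol.numComponents_Istar] at hord
    rw [← cast_minimalDiscriminantInt W, padicValRat.of_int, hord]
    norm_num
  -- `ord₃ Δ(V) = 0` (good reduction at `3` of the globally minimal `V`)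
  have hgood : V.HasGoodReductionAtPrime 3 :=
    LeafShimuraInert.hasGoodReductionAtPrime_three_of_smul_eq_quadraticTwist_negThree W hadd hsub CV hV
  have hΔV : padicValRat 3 V.Δ = 0 := by
    rw [← cast_minimalDiscriminantInt V, padicValRat.of_int]
    exact_mod_cast padicValInt.eq_zero_of_not_dvd (V.not_dvd_minimalDiscriminantInt_of_hasGoodReductionAtPrime' 3 hgood)
  -- `Δ(V) = u⁻¹² · (−3)⁶ · Δ(W)`
  have hΔeq : V.Δ = ((CV.u : ℚ)⁻¹) ^ 12 * ((-3 : ℚ) ^ 6 * W.Δ) := by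
    rw [← hV, variableChange_Δ, quadraticTwist_Δ, Units.val_inv_eq_inv_val]
  have hu0 : (CV.u : ℚ) ≠ 0 := CV.u.ne_zero
  have hW0 : W.Δ ≠ 0 := W.isUnit_Δ.ne_zero
  have h3 : padicValRat 3 (-3 : ℚ) = 1 := by
    rw [padicValRat.neg]; exact_mod_cast padicValRat.self (p := 3) (by norm_num)
  have h36 : padicValRat 3 ((-3 : ℚ) ^ 6) = 6 := by
    rw [padicValRat.pow (-3 : ℚ), h3]; norm_num
  have hval : padicValRat 3 V.Δ = 12 * (-padicValRat 3 (CV.u : ℚ)) + (6 + 6) := by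
    rw [hΔeq, padicValRat.mul (pow_ne_zero _ (inv_ne_zero hu0)) (mul_ne_zero (pow_ne_zero _ (by norm_num)) hW0),
      padicValRat.pow ((CV.u : ℚ)⁻¹), padicValRat.inv, padicValRat.mul (pow_ne_zero _ (by norm_num)) hW0, h36, hΔW]
    push_cast; ring
  rw [hΔV] at hval
  linarith

/-! ## §2 `u = ±3` -/

/-- **`u(C_V) = ±3`**: `u/3` is a unit at every finite place of `ℚ` — at `v ∤ 6` and at `v = 2` because `u` is (Pal 2012 Prop. 2.5:
`valuation_u_eq_one_of_smul_quadraticTwist_of_odd_of_not_dvd`, `…_two_of_emod_four_eq_one` with `−3 ≡ 1 (mod 4)`) and `3` is, at `v = 3` by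
§1 — hence `u/3, 3/u ∈ ℤ`, `u/3 = ±1`. [cite: Pal2012, Prop. 2.5 and Cor. 2.6] [cite: SilvermanAEC2009, VII.1 Prop. 1.3(b)] -/
theorem u_eq_three_or_eq_neg_three
    (W : WeierstrassCurve ℚ) [W.IsElliptic] [W.IsGloballyMinimal] (hadd : Addv W 3) (hsub : SubGss W 3)
    {V : WeierstrassCurve ℚ} [V.IsElliptic] [V.IsGloballyMinimal]
    (CV : VariableChange ℚ) (hV : CV • W.quadraticTwist (-3) = V) :
    (CV.u : ℚ) = 3 ∨ (CV.u : ℚ) = -3 := by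
  haveI h3F : Fact (Nat.Prime 3) := ⟨Nat.prime_three⟩
  have hu0 : (CV.u : ℚ) ≠ 0 := CV.u.ne_zero
  have hV' : CV • W.quadraticTwist (((-3 : ℤ)) : ℚ) = V := by
    rw [show (((-3 : ℤ)) : ℚ) = (-3 : ℚ) by norm_num]; exact hV
  set x : ℚ := (CV.u : ℚ) / 3 with hx_def
  have hx0 : x ≠ 0 := div_ne_zero hu0 (by norm_num)
  have h3u : padicValRat 3 (CV.u : ℚ) = 1 := padicValRat_three_u_eq_one W hadd hsub CV hV
  -- every valuation of `x` is `1`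
  have hall : ∀ v : HeightOneSpectrum (𝓞 ℚ), v.valuation ℚ x = 1 := by
    intro v
    have hgen : (primesEquiv v : ℕ) = natGenerator v := rfl
    by_cases hv3 : natGenerator v = 3
    · -- at the place over `3`: `|u|_v = |3|_v = exp(−1)`
      have hu3 : v.valuation ℚ (CV.u : ℚ) = WithZero.exp (-1 : ℤ) := by
        rw [valuation_eq_exp_neg_padicValRat_ringOfIntegers v hu0, hv3, h3u]
      have h33 : v.valuation ℚ (3 : ℚ) = WithZero.exp (-1 : ℤ) := by
        have h := Literature.NumberTheory.GaloisRepresentations.Rat.valuation_natGenerator v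
        rwa [hv3, Nat.cast_ofNat] at h
      rw [hx_def, map_div₀, hu3, h33, div_self (WithZero.coe_ne_zero)]
    · -- off `3`: `u` is a `v`-unit (Pal) and so is `3`
      have huv : v.valuation ℚ (CV.u : ℚ) = 1 := by
        by_cases hv2 : (primesEquiv v : ℕ) = 2
        · exact W.valuation_u_eq_one_of_smul_quadraticTwist_two_of_emod_four_eq_one v hv2 (d := -3) (by decide) V CV hV'
        · have hvd : ¬ ((primesEquiv v : ℕ) : ℤ) ∣ (-3 : ℤ) := by
            intro h
            have h' : ((primesEquiv v : ℕ) : ℤ) ∣ ((3 : ℕ) : ℤ) := by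
              have := (Int.dvd_neg).mpr h
              simpa using this
            have h'' : (primesEquiv v : ℕ) ∣ 3 := Int.natCast_dvd_natCast.mp h'
            exact hv3 (hgen ▸ (Nat.prime_dvd_prime_iff_eq (primesEquiv v).2 Nat.prime_three).mp h'')
          exact W.valuation_u_eq_one_of_smul_quadraticTwist_of_odd_of_not_dvd v hv2 hvd V CV hV'
      have h3v : v.valuation ℚ (3 : ℚ) = 1 := by
        have h := Literature.NumberTheory.GaloisRepresentations.Rat.valuation_intCast_eq_one v (n := 3) (by
          intro hd
          have hd' : (natGenerator v : ℤ) ∣ ((3 : ℕ) : ℤ) := by simpa using hd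
          exact hv3 ((Nat.prime_dvd_prime_iff_eq (prime_natGenerator v) Nat.prime_three).mp
            (Int.natCast_dvd_natCast.mp hd')))
        simpa using h
      rw [hx_def, map_div₀, huv, h3v, div_one]
  -- `x` and `x⁻¹` are integers, so `x = ±1`
  -- adapted from Literature/NumberTheory/EllipticCurves/Pal2012/QuadraticTwistPeriodProofs.lean (`u_eq_one_or_eq_neg_one_of_smul_quadraticTwist`)
  have hxi : x ∈ (algebraMap (𝓞 ℚ) ℚ).range :=
    HeightOneSpectrum.mem_integers_of_valuation_le_one ℚ x (fun v ↦ (hall v).le)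
  have hxii : x⁻¹ ∈ (algebraMap (𝓞 ℚ) ℚ).range :=
    HeightOneSpectrum.mem_integers_of_valuation_le_one ℚ x⁻¹ (fun v ↦ by rw [map_inv₀, hall v, inv_one])
  obtain ⟨y, hy⟩ := hxi
  obtain ⟨yi, hyi⟩ := hxii
  obtain ⟨U, hU⟩ : ∃ n : ℤ, (n : ℚ) = x := ⟨Rat.ringOfIntegersEquiv y, (Rat.ringOfIntegersEquiv_apply_coe y).trans hy⟩
  obtain ⟨Ui, hUi⟩ : ∃ n : ℤ, (n : ℚ) = x⁻¹ :=
    ⟨Rat.ringOfIntegersEquiv yi, (Rat.ringOfIntegersEquiv_apply_coe yi).trans hyi⟩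
  have hUU : Ui * U = 1 := by
    exact_mod_cast (show (Ui : ℚ) * U = 1 by rw [hU, hUi, inv_mul_cancel₀ hx0])
  have hx3 : (CV.u : ℚ) = 3 * x := by rw [hx_def]; field_simp
  rcases Int.eq_one_or_neg_one_of_mul_eq_one' hUU with ⟨-, h⟩ | ⟨-, h⟩
  · left; rw [hx3, ← hU, h]; norm_num
  · right; rw [hx3, ← hU, h]; norm_num

/-! ## §3 The covolume ledger -/

/-- **THE `3`-ADIC PERIOD LEDGER: `covol(Λ_V) = 3 · covol(Λ_W)`.** For a leaf curve `W` (globally minimal, `Addv W 3`, `SubGss W 3`), any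
globally minimal model `V = C_V • W^{(−3)}` of its `3`-good twist partner, and Néron-type period pairs `L` of `W`, `L_V` of `V`:
`covol(Λ_V) = 3·covol(Λ_W)` — `Λ(W^{(−3)}) = s⁻¹Λ(W)` (`s² = −3`, Pal Lemma 3.1), `Λ(V) = u·Λ(W^{(−3)})` (`u = u(C_V)`),
`covol(cΛ) = |c|²covol(Λ)`, and `|u|² / |s|² = 9/3 = 3` (§2). So in Cai–Shu–Tian's constant for `(V, χ)` with `c = 3` the `√(c²) = 3` cancels
against this `3`: the (DISPLAY-L) stub's constant read for `W` is `3`-adically right. [cite: Pal2012, Lemma 3.1, Prop. 2.5]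
[cite: SilvermanAEC2009, III.1 Table 3.1] [cite: CaiShuTian2014, Thm. 1.1] [cite: ZagierCMB1985, §1] -/
theorem covolume_partner_eq_three_mul
    (W : WeierstrassCurve ℚ) [W.IsElliptic] [W.IsGloballyMinimal] (hadd : Addv W 3) (hsub : SubGss W 3)
    {V : WeierstrassCurve ℚ} [V.IsElliptic] [V.IsGloballyMinimal]
    (CV : VariableChange ℚ) (hV : CV • W.quadraticTwist (-3) = V)
    {L LV : PeriodPair} (hL : IsNeronLatticeOf (W.baseChange ℂ) L) (hLV : IsNeronLatticeOf (V.baseChange ℂ) LV) :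
    ZLattice.covolume LV.lattice = 3 * ZLattice.covolume L.lattice := by
  -- `s² = −3` in `ℂ`
  obtain ⟨s, hs⟩ := IsAlgClosed.exists_pow_nat_eq (((-3 : ℚ)) : ℂ) zero_lt_two
  have hs0 : s ≠ 0 := by
    rintro rfl
    have : (((-3 : ℚ)) : ℂ) = 0 := by rw [← hs]; simp
    norm_num at this
  -- the Néron pair of the twisted equation and of `V`
  have hLT : IsNeronLatticeOf ((W.quadraticTwist (-3 : ℚ)).baseChange ℂ) (L.mulLeft s⁻¹ (inv_ne_zero hs0)) :=
    isNeronLatticeOf_quadraticTwist_of_sq_eq (-3 : ℚ) hL hs0 hs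
  have hLV' : IsNeronLatticeOf ((CV • W.quadraticTwist (-3 : ℚ)).baseChange ℂ) LV := by rw [hV]; exact hLV
  have hlat := IsNeronLatticeOf.lattice_eq_mulLeft_of_smul CV hLT hLV'
  -- covolumes
  have hns : ‖s‖ ^ 2 = 3 := by
    have h := congrArg norm hs
    rw [norm_pow] at h
    rw [h]; norm_num
  have hu : ‖(((CV.u : ℚ)) : ℂ)‖ ^ 2 = 9 := by
    rcases u_eq_three_or_eq_neg_three W hadd hsub CV hV with h | h
    · rw [h]; norm_num
    · rw [h]; norm_num
  rw [hlat, PeriodPair.covolume_mulLeft_lattice, PeriodPair.covolume_mulLeft_lattice, norm_inv, inv_pow, hns, hu]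
  ring

end Summit.BirchSwinnertonDyer.BirchSwinnertonDyer.Theorems.LeafPartnerCovolume

end
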